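/- Copyright: the b2b-balaban cell (near-miss cell 7), T⁴-continuum fan-out; row NE7b OWNER lineage `t4-ne7b-p1`
(gen 57) — (ρ2) in R-OWNER-49-1's order of attack after g55's (ρ0) and g56's (ρ1): «THE CURLY ENVELOPE IS ONE SUM OF
SLICE SUPREMA».  Released under the licence of the surrounding project. -/
import Summits.QuantumFields.BalabanUV.T4Continuum.Support.HistoryBankingFibreCount
import Summits.QuantumFields.BalabanUV.T4Continuum.Support.B16HistoryInputFamily

/-!
# (ρ2) «THE CURLY ENVELOPE IS ONE SUM OF SLICE SUPREMA»: the displayed slice envelope of a key fibre is, once its data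
is quantified away, ONE real inequality per cutoff, source and key — and the fibre-mass junction needs neither the
envelope nor the decoration

Summits-side support leaf of the T⁴-continuum cell (rung (B)+1 on a FINITE torus only; NOT infinite volume, NOT the
mass gap, NOT the Clay statement; NOT a proof of the spine estimate NE7b — the cell's OWN estimate, NOT PRINTED, NOT
PROVED).  [folklore] finite combinatorics and `Finset.max'` bookkeeping over M1's index (`B16HistoryIndexedRepr.HIndex`;
`B16HistoryIndexedFamily`: `HIndex.Idx`, `termSet`), the fibre of a key map (`T4LiveClassFibration.fibre`), leaf-02's
slice (`HistoryBankingFibreDecorSlice`: `sliceOf`, `CslOf`, `SIdx`, `eq_of_mem_termSet`), the owner's g56 count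
(`HistoryBankingFibreCount`: `pairsOf`, `mkIdx`, `fibreMass_of_count`, `fibreMass_of_count_MULTOf`) and M2 brick B's
factor data (`B16HistoryInputFamily`: `HistFactors.wC`∕`BV`); no `structure` hypothesis shape, no `[cite:]` tag, no
`def … : Prop` fact of Bałaban's, zero `sorry`.  B16 = [Balaban1989LargeFieldII] pp. 388–390 — (1.90) the polymer
expansion of the curly bracket with activities `F(X′)` (1.91), their estimation (1.92)–(1.96), the bound (1.97)
«|F(X′)| ≤ c₁ exp(−(1+β)κ d_k(X′))» with `c₁ = exp(−p₀(g_k))` or `α^{1∕3}` (p. 390 l. 1–3), the exponentiation (1.98)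
«{ } = exp R′^{(k)} = exp Σ_X R′^{(k)}(X)» and the bounds (1.99)∕(1.100) — is quoted as the LOCATOR of a hypothesis
shape only; nothing printed is asserted.

WHY.  After R-OWNER-49-1 ∕ IR-49-1 the located display (ρ) `FibreMass` of the (α) record of record is read off the
key through (ρ0) (g55: typed at the input level, `HistoryGenealogyLiveIndex`), (ρ1) (g56: THE HISTORY COUNT,
`HistoryBankingFibreCount`), (ρ2) = the four items {`kdV` (data: the slice envelope `v K t k ⟨K, a, c⟩`), `kdV0`,
`kdEnv`, `kdW`} of `HistReadDataLWK` (equivalently `IndexDecor`'s `v`∕`v_nonneg`∕`envelope`∕`hW`), classed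
T∕PARAMETRIC, and (ρ3) (KERNEL modulo FIBRE-1, served).  This file shows WHAT (ρ2) ASSERTS ONCE ITS DATA IS QUANTIFIED
AWAY: at every cutoff `K`, source `t` and key `k`, with `cw τ = |wC K t a c|·e^{BV K t a h ℓ c}` the exponentiated
first-class material of the term `τ = ⟨K, a, (h, ℓ, c)⟩`, the SUM over the slices `⟨K, a, c⟩` met in the fibre of `k`
of the SUPREMUM of `cw` over the fibre terms of that slice — i.e. over (ρ1)'s history pairs `pairsOf K k a c` — is at
most `W K`; NOTHING ELSE: a nonnegative slice envelope dominating `cw` with slice sum `≤ W K` EXISTS iff this one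
inequality holds (`exists_envelope_iff_supSum`; the suprema, floored at `0`, ARE the least envelope).  So (ρ2)'s
content is print's (1.97) summed over the localization domains of the first-class material under (1.98), READ per key
fibre as one number per slice — T∕PARAMETRIC BY VALUE exactly as before (`W K ≤ W∞` T-extensive, refuter F76 (iii)) —
and the fibre-mass junction can be fed the SUPSUM and the COUNT directly (`fibreMass_of_supSum_count`), with no
envelope data and no decoration data at all.

WHAT.  §1 **`termsOf kmem K k s`** (the fibre terms of slice `s`), **`supOf kmem K k cw s`** (THE SLICE SUPREMUM,
floored at `0`: `max' (insert 0 (image cw (termsOf …)))`), `supOf_nonneg`, **`le_supOf`**, **`supOf_le`**, `supOf_le_iff`,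
`supOf_eq_zero_of_not_mem`; **`supSum kmem K k cw`** `= Σ_{s ∈ CslOf} supOf … s`, `supSum_nonneg`.  §2 (⇒)
**`supOf_le_of_envelope`**, **`supSum_le_of_envelope`**: any nonnegative envelope dominating `cw` slice-wise dominates
the suprema, so its slice sum bounds the SUPSUM.  §3 (⇐) + iff: **`exists_envelope_iff_supSum`**.  §4 the supremum of
an explicit slice `⟨K, a, c⟩` is a supremum over the HISTORY PAIRS: `termsOf_mk_eq_image_pairsOf` (g56's bijection
`mkIdx K a c`), **`le_supOf_mk`**, **`supOf_mk_le_iff`**.  §5 junctions: **`fibreMass_of_supSum_count`** (the conclusion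
of `fibreMass_of_count` — `Σ_{τ ∈ fibre k} dmass τ ≤ W · B` — from the SUPSUM, the COUNT `≤ B`, and `dmass ≤ cw` on the
fibre) and **`fibreMass_of_supSum_count_MULTOf`** (at the letters of record).  §6 the record's letters: **`cwOf Φf t`**
(the curly weight of a term off M2 brick B's `HistFactors`), `cwOf_nonneg`, and **`exists_kdV_iff_supSum`** — the
(ρ2) items {`kdV`, `kdV0`, `kdEnv`, `kdW`} of `HistReadDataLWK`, generic in the key map `kmem`, the displayed key
classes `bad K`, the thresholds `l₀`∕`K₀` and the envelope `W` (at `kmem := kmemA …`, `bad K := badGMems … K` they are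
the record's fields VERBATIM), with `kdV` existentially quantified ⟺ `∀ K t, |t| ≤ l₀ → K₀ ≤ K → ∀ k ∈ bad K,
supSum kmem K k (cwOf Φf t) ≤ W K`.  §7 a decided toy on g56's one-point skeleton: the SUPSUM of the constant weight `r`
is `max r 0` (`Toy.supSum_const`), so at `W := 1∕2 < r := 1` NO envelope exists (`Toy.no_envelope_half`) while at
`W := 1` one does — (ρ2) constrains the reading, it is not a property of M1's skeleton.

HONEST SCOPE.  Bookkeeping over OUR carriers: an equivalence between two hypothesis SHAPES and a junction.  (ρ2) is NOT
discharged — the SUPSUM inequality is as much a reading of (1.90)∕(1.97)–(1.100) onto the key fibre as the envelope was,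
and its VALUE `W K` stays print's claim ∕ the T-extensive `W∞`; what is gained is its FORM: one inequality per
`(K, t, k)`, no data.  BY-NAME EFFECT ON THE WALL: row `resum`∕(ρ) — (ρ2) RE-WORDED ONLY («T∕PARAMETRIC, slice envelope
`v` with `Σ v ≤ W K`» ↦ «T∕PARAMETRIC, THE SUM OVER THE SLICES MET OF THE SUPREMA OVER THE HISTORY PAIRS of
`|wC|·e^{BV}` is `≤ W K`; the envelope data `kdV` is eliminable»); R∕T-rows by count UNCHANGED.  NE7b NOT PRINTED ∕ NOT
PROVED; spine 0∕9.  HONEST DEPENDENCY (cell): continuum YM on T⁴ ⇐ BetaPertH ∧ nine spine estimates (0/9 proved);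
BetaPertH ⇐ (D1) ∧ (D4) ∧ CAP+tail; G-an2-4 gates asym, D1 and NE2/3/4.  This file changes none of it.
-/

open Finset
open Literature.MathematicalPhysics.QuantumFieldTheory.Balaban1983to89
open T4PersistenceDictionary T4LiveClassFibration
open Summit.QuantumFields.BalabanUV.T4Continuum.HistoryPriceNodeSum
open Summit.QuantumFields.BalabanUV.T4Continuum.HistoryPriceKeys
open Summit.QuantumFields.BalabanUV.T4Continuum.HistoryBankingFibreResum
open Summit.QuantumFields.BalabanUV.T4Continuum.HistoryBankingFibreDecorKeys
open Summit.QuantumFields.BalabanUV.T4Continuum.HistoryBankingFibreDecorSlice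
open Summit.QuantumFields.BalabanUV.T4Continuum.HistoryBankingFibreCount
open Summit.QuantumFields.BalabanUV.T4Continuum.B16HistoryIndexedRepr

namespace Summit.QuantumFields.BalabanUV.T4Continuum.HistoryBankingFibreEnvelope

noncomputable section

variable {DomK : ℕ → Type*} {I : (K : ℕ) → HIndex (DomK K)} {ω : Type*} [DecidableEq ω]

/-! ## §1 The terms of a slice in a key fibre; the slice supremum of a term function; the sum of suprema -/

open Classical in
/-- **THE FIBRE TERMS OF A SLICE**: the terms of the fibre of the key `k` at cutoff `K` whose slice (cutoff, outer
summand, curly summand) is `s`. [folklore] -/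
def termsOf (kmem : ℕ → HIndex.Idx I → Finset ω) (K : ℕ) (k : Finset ω) (s : SIdx I) : Finset (HIndex.Idx I) :=
  (fibre kmem (HIndex.termSet I) K k).filter fun τ => sliceOf I τ = s

open Classical in
/-- membership in the slice's terms [folklore] -/
theorem mem_termsOf {kmem : ℕ → HIndex.Idx I → Finset ω} {K : ℕ} {k : Finset ω} {s : SIdx I} {τ : HIndex.Idx I} :
    τ ∈ termsOf kmem K k s ↔ τ ∈ fibre kmem (HIndex.termSet I) K k ∧ sliceOf I τ = s := by
  unfold termsOf
  rw [Finset.mem_filter]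

/-- a slice not met in the fibre has no terms [folklore] -/
theorem termsOf_eq_empty_of_not_mem {kmem : ℕ → HIndex.Idx I → Finset ω} {K : ℕ} {k : Finset ω} {s : SIdx I}
    (hs : s ∉ CslOf I kmem K k) : termsOf kmem K k s = ∅ :=
  Finset.eq_empty_of_forall_notMem fun _ hτ =>
    hs ((mem_termsOf.1 hτ).2 ▸ sliceOf_mem_CslOf (mem_termsOf.1 hτ).1)

open Classical in
/-- **THE SLICE SUPREMUM** of a term function `cw` over the fibre terms of slice `s`, FLOORED AT `0` (so it is defined
and nonnegative on every slice, met or not): `max' (insert 0 (cw '' termsOf …))`. [folklore] -/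
def supOf (kmem : ℕ → HIndex.Idx I → Finset ω) (K : ℕ) (k : Finset ω) (cw : HIndex.Idx I → ℝ) (s : SIdx I) : ℝ :=
  (insert (0 : ℝ) ((termsOf kmem K k s).image cw)).max' (Finset.insert_nonempty _ _)

section Sup

variable {kmem : ℕ → HIndex.Idx I → Finset ω} {K : ℕ} {k : Finset ω} {cw : HIndex.Idx I → ℝ}

/-- the slice supremum is nonnegative [folklore] -/
theorem supOf_nonneg {s : SIdx I} : 0 ≤ supOf kmem K k cw s := by
  unfold supOf
  exact Finset.le_max' _ _ (Finset.mem_insert_self _ _)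

/-- **A FIBRE TERM's WEIGHT IS BELOW ITS SLICE's SUPREMUM**. [folklore] -/
theorem le_supOf {τ : HIndex.Idx I} (hτ : τ ∈ fibre kmem (HIndex.termSet I) K k) :
    cw τ ≤ supOf kmem K k cw (sliceOf I τ) := by
  unfold supOf
  exact Finset.le_max' _ _ (Finset.mem_insert_of_mem (Finset.mem_image_of_mem cw (mem_termsOf.2 ⟨hτ, rfl⟩)))

/-- **THE SLICE SUPREMUM IS THE LEAST NONNEGATIVE BOUND** of the weights of the slice's fibre terms. [folklore] -/
theorem supOf_le {s : SIdx I} {b : ℝ} (hb : 0 ≤ b)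
    (h : ∀ τ ∈ fibre kmem (HIndex.termSet I) K k, sliceOf I τ = s → cw τ ≤ b) : supOf kmem K k cw s ≤ b := by
  unfold supOf
  refine Finset.max'_le _ _ _ fun x hx => ?_
  rcases Finset.mem_insert.1 hx with rfl | hx
  · exact hb
  · obtain ⟨τ, hτ, rfl⟩ := Finset.mem_image.1 hx
    exact h τ (mem_termsOf.1 hτ).1 (mem_termsOf.1 hτ).2

/-- the slice supremum is below a nonnegative `b` iff every fibre term of the slice weighs at most `b` [folklore] -/
theorem supOf_le_iff {s : SIdx I} {b : ℝ} (hb : 0 ≤ b) :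
    supOf kmem K k cw s ≤ b ↔ ∀ τ ∈ fibre kmem (HIndex.termSet I) K k, sliceOf I τ = s → cw τ ≤ b := by
  refine ⟨fun h τ hτ hs => ?_, supOf_le hb⟩
  rw [← hs] at h
  exact (le_supOf hτ).trans h

/-- off the slices met in the fibre the supremum is the floor `0` [folklore] -/
theorem supOf_eq_zero_of_not_mem {s : SIdx I} (hs : s ∉ CslOf I kmem K k) : supOf kmem K k cw s = 0 :=
  le_antisymm (supOf_le le_rfl fun _ hτ hτs => absurd (hτs ▸ sliceOf_mem_CslOf hτ) hs) supOf_nonneg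

end Sup

open Classical in
/-- **THE SUM OF SLICE SUPREMA** («SUPSUM») of a term function over the slices met in the fibre of the key `k` at
cutoff `K`. [folklore] -/
def supSum (kmem : ℕ → HIndex.Idx I → Finset ω) (K : ℕ) (k : Finset ω) (cw : HIndex.Idx I → ℝ) : ℝ :=
  ∑ s ∈ CslOf I kmem K k, supOf kmem K k cw s

section Sum

variable {kmem : ℕ → HIndex.Idx I → Finset ω} {K : ℕ} {k : Finset ω} {cw : HIndex.Idx I → ℝ}

/-- unfolding [folklore] -/
theorem supSum_eq : supSum kmem K k cw = ∑ s ∈ CslOf I kmem K k, supOf kmem K k cw s := rfl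
/-- the SUPSUM is nonnegative [folklore] -/
theorem supSum_nonneg : 0 ≤ supSum kmem K k cw := Finset.sum_nonneg fun _ _ => supOf_nonneg

/-! ## §2 (⇒) An envelope of the fibre dominates the slice suprema -/

/-- **A NONNEGATIVE ENVELOPE DOMINATING THE WEIGHTS SLICE-WISE DOMINATES THE SLICE SUPREMA** on the slices met.
[folklore] -/
theorem supOf_le_of_envelope {v : SIdx I → ℝ} (hv : ∀ s ∈ CslOf I kmem K k, 0 ≤ v s)
    (hfac : ∀ τ ∈ fibre kmem (HIndex.termSet I) K k, cw τ ≤ v (sliceOf I τ)) {s : SIdx I}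
    (hs : s ∈ CslOf I kmem K k) : supOf kmem K k cw s ≤ v s :=
  supOf_le (hv s hs) fun τ hτ hτs => by rw [← hτs]; exact hfac τ hτ

/-- **(ρ2)'s DISPLAYS IMPLY THE SUPSUM INEQUALITY**: a nonnegative slice envelope dominating the weights with slice sum
`≤ W` (the record's `kdV0`∕`kdEnv`∕`kdW` at one cutoff, source and key) gives `supSum ≤ W`. [folklore] -/
theorem supSum_le_of_envelope {v : SIdx I → ℝ} {W : ℝ} (hv : ∀ s ∈ CslOf I kmem K k, 0 ≤ v s)
    (hW : ∑ s ∈ CslOf I kmem K k, v s ≤ W)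
    (hfac : ∀ τ ∈ fibre kmem (HIndex.termSet I) K k, cw τ ≤ v (sliceOf I τ)) : supSum kmem K k cw ≤ W :=
  (Finset.sum_le_sum fun _ hs => supOf_le_of_envelope hv hfac hs).trans hW

/-! ## §3 (⇐) The slice suprema ARE an envelope; the equivalence -/

/-- **THE SLICE SUPREMA ARE THE LEAST ENVELOPE**: `supOf` is nonnegative, dominates the weights slice-wise, and its slice
sum is the SUPSUM. [folklore] -/
theorem envelope_supOf :
    (∀ s ∈ CslOf I kmem K k, 0 ≤ supOf kmem K k cw s) ∧
      (∑ s ∈ CslOf I kmem K k, supOf kmem K k cw s = supSum kmem K k cw) ∧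
      ∀ τ ∈ fibre kmem (HIndex.termSet I) K k, cw τ ≤ supOf kmem K k cw (sliceOf I τ) :=
  ⟨fun _ _ => supOf_nonneg, rfl, fun _ hτ => le_supOf hτ⟩

variable (kmem K k cw) in
/-- **(ρ2) ⟺ THE SUPSUM** (one cutoff, one key, one term function): a nonnegative slice envelope on the slices met in
the fibre, dominating the weight of every fibre term at its slice and summing to at most `W` — the (ρ2) display triple
`v_nonneg` + `envelope` + `hW` for SOME data `v` — EXISTS iff the sum over the slices met of the slice suprema is at
most `W`.  The content of (ρ2) is this one inequality; the data `v` is eliminable. [folklore] -/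
theorem exists_envelope_iff_supSum (W : ℝ) :
    (∃ v : SIdx I → ℝ, (∀ s ∈ CslOf I kmem K k, 0 ≤ v s) ∧ (∑ s ∈ CslOf I kmem K k, v s ≤ W) ∧
        ∀ τ ∈ fibre kmem (HIndex.termSet I) K k, cw τ ≤ v (sliceOf I τ)) ↔
      supSum kmem K k cw ≤ W :=
  ⟨fun ⟨_, hv, hW, hfac⟩ => supSum_le_of_envelope hv hW hfac,
    fun h => ⟨supOf kmem K k cw, fun _ _ => supOf_nonneg, h, fun _ hτ => le_supOf hτ⟩⟩

/-! ## §4 The supremum of an explicit slice is a supremum over its HISTORY PAIRS -/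

open Classical in
/-- the fibre terms of the slice `⟨K, a, c⟩` are the images of its history pairs under g56's `mkIdx K a c` [folklore] -/
theorem termsOf_mk_eq_image_pairsOf (a : (I K).Adm) (c : (I K).HC) :
    termsOf kmem K k ⟨K, a, c⟩ = (pairsOf kmem K k a c).image (mkIdx K a c) := by
  ext τ
  constructor
  · intro hτ
    obtain ⟨hf, hs⟩ := mem_termsOf.1 hτ
    obtain ⟨a', h, l, c', -, rfl⟩ := eq_of_mem_termSet (mem_fibre.1 hf).1
    have hs' : sliceOf I ⟨K, a', (h, l, c')⟩ = sliceOf I ⟨K, a, (h, l, c)⟩ := by rw [hs, sliceOf_mk]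
    obtain ⟨rfl, rfl⟩ := sliceOf_eq_iff.1 hs'
    exact Finset.mem_image.2 ⟨(h, l), mem_pairsOf.2 hf, rfl⟩
  · intro hτ
    obtain ⟨p, hp, rfl⟩ := Finset.mem_image.1 hτ
    exact mem_termsOf.2 ⟨mem_pairsOf.1 hp, sliceOf_mk I K a p.1 p.2 c⟩

/-- **A HISTORY PAIR's WEIGHT IS BELOW THE SLICE SUPREMUM**. [folklore] -/
theorem le_supOf_mk {a : (I K).Adm} {c : (I K).HC} {p : (I K).HZ × (I K).HL} (hp : p ∈ pairsOf kmem K k a c) :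
    cw ⟨K, a, (p.1, p.2, c)⟩ ≤ supOf kmem K k cw ⟨K, a, c⟩ := by
  have h := le_supOf (cw := cw) (mem_pairsOf.1 hp)
  rwa [sliceOf_mk] at h

/-- **THE SLICE SUPREMUM OF `⟨K, a, c⟩` IS THE LEAST NONNEGATIVE BOUND OF THE WEIGHTS OF ITS HISTORY PAIRS** — the
index (ρ1)'s count counts (`HistoryBankingFibreCount.pairsOf`). [folklore] -/
theorem supOf_mk_le_iff {a : (I K).Adm} {c : (I K).HC} {b : ℝ} (hb : 0 ≤ b) :
    supOf kmem K k cw ⟨K, a, c⟩ ≤ b ↔ ∀ p ∈ pairsOf kmem K k a c, cw ⟨K, a, (p.1, p.2, c)⟩ ≤ b := by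
  rw [supOf_le_iff hb]
  constructor
  · intro h p hp
    exact h _ (mem_pairsOf.1 hp) (sliceOf_mk I K a p.1 p.2 c)
  · intro h τ hτ hs
    obtain ⟨a', h', l, c', -, rfl⟩ := eq_of_mem_termSet (mem_fibre.1 hτ).1
    have hs' : sliceOf I ⟨K, a', (h', l, c')⟩ = sliceOf I ⟨K, a, (h', l, c)⟩ := by rw [hs, sliceOf_mk]
    obtain ⟨rfl, rfl⟩ := sliceOf_eq_iff.1 hs'
    exact h (h', l) (mem_pairsOf.2 hτ)

/-! ## §5 The fibre-mass junction from the SUPSUM and the COUNT (no envelope data, no decoration data) -/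

variable (kmem K k) in
/-- **(ρ) `FibreMass` FROM THE SUPSUM AND THE COUNT** — the conclusion of g56's `fibreMass_of_count` ∕ the shape of
`HistReadDataL(W).hρ` at one cutoff, key and source value, WITHOUT ENVELOPE OR DECORATION DATA: if every fibre term's
mass is below its weight `cw`, the SUPSUM of `cw` is at most `W`, and at every outer and curly summand the history
count is at most `B ≥ 0`, then `∑_{τ ∈ fibre k} dmass τ ≤ W · B`. [folklore] -/
theorem fibreMass_of_supSum_count (dmass cw : HIndex.Idx I → ℝ) {W B : ℝ} (hS : supSum kmem K k cw ≤ W)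
    (hB : 0 ≤ B) (hcount : ∀ (a : (I K).Adm) (c : (I K).HC), ((pairsOf kmem K k a c).card : ℝ) ≤ B)
    (hfac : ∀ τ ∈ fibre kmem (HIndex.termSet I) K k, dmass τ ≤ cw τ) :
    ∑ τ ∈ fibre kmem (HIndex.termSet I) K k, dmass τ ≤ W * B :=
  fibreMass_of_count kmem K k dmass (v := supOf kmem K k cw) (fun _ _ => supOf_nonneg) hS hB hcount
    fun τ hτ => (hfac τ hτ).trans (le_supOf hτ)

end Sum

/-- **(ρ) `FibreMass` FROM THE SUPSUM AND THE COUNT AT THE LETTERS OF RECORD**: with the decoration sets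
`decG (C w) w.2.1` of a key of (cell, genealogy, physical datum) members and (ρ3)'s per-event letters
`#(C w e) ≤ exp (φ e)`, a history count below `∏_{w ∈ k} #decG (C w) w.2.1` and a SUPSUM `≤ W` give
`∑_{τ ∈ fibre k} dmass τ ≤ W · MULTOf φ k` — leaf-02's `fibreMass_of_genDecoration_idx` with BOTH its (ρ1) hypotheses
{`dec`, `hmem`, `hinj`} and its (ρ2) hypotheses {`v`, `hv`, `hW`, `hfac`} REPLACED by the two sentences. [folklore] -/
theorem fibreMass_of_supSum_count_MULTOf {β γ δ' : Type*} [DecidableEq β] [DecidableEq γ] [DecidableEq δ']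
    (kmem : ℕ → HIndex.Idx I → Finset (γ × Gen PEv × δ')) (K : ℕ) (k : Finset (γ × Gen PEv × δ'))
    (dmass cw : HIndex.Idx I → ℝ) (φ : PEv → ℝ) {W : ℝ} (C : γ × Gen PEv × δ' → PEv → Finset β)
    (hS : supSum kmem K k cw ≤ W)
    (hcount : ∀ (a : (I K).Adm) (c : (I K).HC),
      (pairsOf kmem K k a c).card ≤ ∏ w ∈ k, (decG (C w) w.2.1).card)
    (hfac : ∀ τ ∈ fibre kmem (HIndex.termSet I) K k, dmass τ ≤ cw τ)
    (hC : ∀ w ∈ k, ∀ e ∈ w.2.1.events, ((C w e).card : ℝ) ≤ Real.exp (φ e)) :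
    ∑ τ ∈ fibre kmem (HIndex.termSet I) K k, dmass τ ≤ W * MULTOf φ k :=
  fibreMass_of_count_MULTOf kmem K k dmass φ C (v := supOf kmem K k cw) (fun _ _ => supOf_nonneg) hS hcount
    (fun τ hτ => (hfac τ hτ).trans (le_supOf hτ)) hC

/-! ## §6 The record's letters: the curly weight `cwOf`, and (ρ2)'s four items ⟺ the SUPSUM sentence -/

section Record

variable {d : ℕ}

/-- **THE CURLY WEIGHT OF A TERM** (the exponentiated first-class material M2 brick B reads off the choice):
`cwOf Φf t ⟨K, a, (h, ℓ, c)⟩ = |wC K t a c| · e^{BV K t a h ℓ c}` — the quantity (ρ2)'s `kdEnv`∕`envelope` bounds, and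
the live factor of `dmassOf` (`HistoryRealiseCellsRunSupplyFibreWTVS.dmassOf_eq_of_died_empty` under (ρ0)). [folklore] -/
def cwOf (Φf : HistFactors I d) (t : ℝ) : HIndex.Idx I → ℝ
  | ⟨K, a, (h, l, c)⟩ => |Φf.wC K t a c| * Real.exp (Φf.BV K t a h l c)

/-- the curly weight of an explicit term [folklore] -/
@[simp] theorem cwOf_mk (Φf : HistFactors I d) (t : ℝ) (K : ℕ) (a : (I K).Adm) (h : (I K).HZ) (l : (I K).HL)
    (c : (I K).HC) : cwOf Φf t ⟨K, a, (h, l, c)⟩ = |Φf.wC K t a c| * Real.exp (Φf.BV K t a h l c) := rfl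

/-- the curly weight is nonnegative [folklore] -/
theorem cwOf_nonneg (Φf : HistFactors I d) (t : ℝ) (τ : HIndex.Idx I) : 0 ≤ cwOf Φf t τ := by
  obtain ⟨K, a, h, l, c⟩ := τ
  exact mul_nonneg (abs_nonneg _) (Real.exp_pos _).le

/-- **THE RECORD's (ρ2) ITEMS ⟺ THE SUPSUM SENTENCE.**  Generic in the key map `kmem`, the displayed key classes
`bad K`, the thresholds `l₀`∕`K₀` and the envelope `W` — at `kmem := kmemA n F.L hn _ ℛ`,
`bad K := badGMems (memA n F.L ℛ) jhalf (termSet I) (kmemA …) K` the three conjuncts are the fields `kdV0`, `kdEnv`,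
`kdW` of `HistoryRealiseCellsRunAssemblyWTVSDataLWK.HistReadDataLWK` VERBATIM (and `IndexDecor`'s `v_nonneg`,
`envelope`, `hW` at `slice := sliceOf`, `Csl := CslOf`): SOME slice-envelope data `kdV` with the three displays EXISTS
iff, for every cutoff past the threshold, admissible source and displayed key class, the SUPSUM of the curly weight is
at most `W K`. [folklore] -/
theorem exists_kdV_iff_supSum (kmem : ℕ → HIndex.Idx I → Finset ω) (bad : ℕ → Finset (Finset ω))
    (Φf : HistFactors I d) (l₀ : ℝ) (K₀ : ℕ) (W : ℕ → ℝ) :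
    (∃ kdV : ℕ → ℝ → Finset ω → SIdx I → ℝ,
      (∀ K t k, ∀ s ∈ CslOf I kmem K k, 0 ≤ kdV K t k s) ∧
      (∀ K t, |t| ≤ l₀ → K₀ ≤ K → ∀ k ∈ bad K,
        ∀ (a : (I K).Adm) (h : (I K).HZ) (l : (I K).HL) (c : (I K).HC),
          (⟨K, a, (h, l, c)⟩ : HIndex.Idx I) ∈ fibre kmem (HIndex.termSet I) K k →
            |Φf.wC K t a c| * Real.exp (Φf.BV K t a h l c) ≤ kdV K t k ⟨K, a, c⟩) ∧
      (∀ K t, |t| ≤ l₀ → K₀ ≤ K → ∀ k ∈ bad K, ∑ s ∈ CslOf I kmem K k, kdV K t k s ≤ W K)) ↔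
    ∀ K t, |t| ≤ l₀ → K₀ ≤ K → ∀ k ∈ bad K, supSum kmem K k (cwOf Φf t) ≤ W K := by
  constructor
  · rintro ⟨kdV, h0, henv, hW⟩ K t ht hK k hk
    refine supSum_le_of_envelope (v := kdV K t k) (h0 K t k) (hW K t ht hK k hk) fun τ hτ => ?_
    obtain ⟨a, h, l, c, -, rfl⟩ := eq_of_mem_termSet (mem_fibre.1 hτ).1
    rw [sliceOf_mk, cwOf_mk]
    exact henv K t ht hK k hk a h l c hτ
  · intro hS
    refine ⟨fun K t k s => supOf kmem K k (cwOf Φf t) s, fun K t k s _ => supOf_nonneg,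
      fun K t _ _ k _ a h l c hτ => ?_, fun K t ht hK k hk => hS K t ht hK k hk⟩
    have hle := le_supOf (cw := cwOf Φf t) hτ
    rwa [sliceOf_mk, cwOf_mk] at hle

/-- **THE DATA-FREE (ρ2) GIVES THE RECORD's (ρ2) ITEMS** (the direction a record constructor uses, stated on its own):
from the SUPSUM sentence, the slice suprema of the curly weight serve as `kdV` with `kdV0`∕`kdEnv`∕`kdW`. [folklore] -/
theorem kdV_of_supSum (kmem : ℕ → HIndex.Idx I → Finset ω) (bad : ℕ → Finset (Finset ω)) (Φf : HistFactors I d)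
    (l₀ : ℝ) (K₀ : ℕ) (W : ℕ → ℝ)
    (hS : ∀ K t, |t| ≤ l₀ → K₀ ≤ K → ∀ k ∈ bad K, supSum kmem K k (cwOf Φf t) ≤ W K) :
    (∀ K t k, ∀ s ∈ CslOf I kmem K k, 0 ≤ supOf kmem K k (cwOf Φf t) s) ∧
      (∀ K t, |t| ≤ l₀ → K₀ ≤ K → ∀ k ∈ bad K,
        ∀ (a : (I K).Adm) (h : (I K).HZ) (l : (I K).HL) (c : (I K).HC),
          (⟨K, a, (h, l, c)⟩ : HIndex.Idx I) ∈ fibre kmem (HIndex.termSet I) K k →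
            |Φf.wC K t a c| * Real.exp (Φf.BV K t a h l c) ≤ supOf kmem K k (cwOf Φf t) ⟨K, a, c⟩) ∧
      (∀ K t, |t| ≤ l₀ → K₀ ≤ K → ∀ k ∈ bad K, ∑ s ∈ CslOf I kmem K k, supOf kmem K k (cwOf Φf t) s ≤ W K) := by
  refine ⟨fun K t k s _ => supOf_nonneg, fun K t _ _ k _ a h l c hτ => ?_, fun K t ht hK k hk => hS K t ht hK k hk⟩
  have hle := le_supOf (cw := cwOf Φf t) hτ
  rwa [sliceOf_mk, cwOf_mk] at hle

end Record

/-! ## §7 A decided toy: on g56's one-point skeleton the SUPSUM of a constant weight `r` is `max r 0` -/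

namespace Toy

open HistoryBankingFibreCount.Toy

/-- the one term of the one-point skeleton at cutoff `K` [folklore] -/
def τ₁ (K : ℕ) : HIndex.Idx I₁ := ⟨K, (), ((), (), ())⟩

/-- it is a term of the level [folklore] -/
theorem τ₁_mem_termSet (K : ℕ) : τ₁ K ∈ HIndex.termSet I₁ K := by
  refine mk_mem_termSet_iff.2 ?_
  show (((), (), ()) : Unit × Unit × Unit) ∈ (I₁ K).HZs () ×ˢ ((I₁ K).HYs () ×ˢ (I₁ K).HCs ())
  exact Finset.mem_product.2 ⟨Finset.mem_singleton_self _,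
    Finset.mem_product.2 ⟨Finset.mem_singleton_self _, Finset.mem_singleton_self _⟩⟩

/-- it lies in the fibre of the one key `{()}` [folklore] -/
theorem τ₁_mem_fibre (K : ℕ) : τ₁ K ∈ fibre kmem₁ (HIndex.termSet I₁) K {()} :=
  mem_fibre.2 ⟨τ₁_mem_termSet K, rfl⟩

/-- every term of the level IS the one term [folklore] -/
theorem eq_τ₁_of_mem {K : ℕ} {τ : HIndex.Idx I₁} (hτ : τ ∈ HIndex.termSet I₁ K) : τ = τ₁ K := by
  obtain ⟨a, h, l, c, -, rfl⟩ := eq_of_mem_termSet hτ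
  rfl

/-- the one slice met in the fibre [folklore] -/
theorem CslOf_eq (K : ℕ) : CslOf I₁ kmem₁ K {()} = {sliceOf I₁ (τ₁ K)} := by
  ext s
  rw [mem_CslOf, Finset.mem_singleton]
  constructor
  · rintro ⟨τ, hτ, rfl⟩
    rw [eq_τ₁_of_mem (mem_fibre.1 hτ).1]
  · rintro rfl
    exact ⟨τ₁ K, τ₁_mem_fibre K, rfl⟩

/-- the slice supremum of the constant weight `r` at the met slice is `max r 0` [folklore] -/
theorem supOf_const (K : ℕ) (r : ℝ) : supOf kmem₁ K {()} (fun _ => r) (sliceOf I₁ (τ₁ K)) = max r 0 := by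
  refine le_antisymm (supOf_le (le_max_right _ _) fun _ _ _ => le_max_left _ _) (max_le ?_ supOf_nonneg)
  exact le_supOf (cw := fun _ => r) (τ₁_mem_fibre K)

/-- **THE TOY's SUPSUM**: `supSum kmem₁ K {()} (fun _ => r) = max r 0`. [folklore] -/
theorem supSum_const (K : ℕ) (r : ℝ) : supSum kmem₁ K {()} (fun _ => r) = max r 0 := by
  rw [supSum_eq, CslOf_eq, Finset.sum_singleton, supOf_const]

/-- **CONTENT**: with the unit weight and `W := 1∕2` the SUPSUM sentence FAILS, hence (`exists_envelope_iff_supSum`) NO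
nonnegative slice envelope with slice sum `≤ 1∕2` dominates the weight — (ρ2) constrains the reading; at `W := 1` it
holds and the suprema are the envelope. [folklore] -/
theorem no_envelope_half (K : ℕ) :
    (¬ ∃ v : SIdx I₁ → ℝ, (∀ s ∈ CslOf I₁ kmem₁ K {()}, 0 ≤ v s) ∧ (∑ s ∈ CslOf I₁ kmem₁ K {()}, v s ≤ 1 / 2) ∧
        ∀ τ ∈ fibre kmem₁ (HIndex.termSet I₁) K {()}, (fun _ => (1 : ℝ)) τ ≤ v (sliceOf I₁ τ)) ∧
      ∃ v : SIdx I₁ → ℝ, (∀ s ∈ CslOf I₁ kmem₁ K {()}, 0 ≤ v s) ∧ (∑ s ∈ CslOf I₁ kmem₁ K {()}, v s ≤ 1) ∧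
        ∀ τ ∈ fibre kmem₁ (HIndex.termSet I₁) K {()}, (fun _ => (1 : ℝ)) τ ≤ v (sliceOf I₁ τ) := by
  rw [exists_envelope_iff_supSum, exists_envelope_iff_supSum, supSum_const]
  norm_num

end Toy

end

end Summit.QuantumFields.BalabanUV.T4Continuum.HistoryBankingFibreEnvelope
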